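import Summits.RiemannHypothesis.RiemannHypothesis.Theorems.WeilTwoPrimeDeflM80FBase
import Literature.NumberTheory.LFunctions.WeilBlockRowsFast
import HarnessLib

/-!
# Deflated two-prime certificate (weilCertDeflM80F): the Bessel block claim `Hp = C H Cᵀ` (parity 1), rows 50–54, fast check

`WeilCert.checkHpRowT` (linear traversals) instead of the indexed `checkHpRow` decide.  Pure proof file.
-/

set_option linter.dupNamespace false

noncomputable section

namespace Summit.RiemannHypothesis.RiemannHypothesis.Theorems.EvenWinsBeyondArch

open Literature.NumberTheory.LFunctions

set_option maxHeartbeats 0 in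
/-- Fast kernel check of claim row 50 of `Hp = C H Cᵀ` (parity 1; linear traversals, triangular `C`). [folklore] -/
theorem checkHpRowT1_50_weilCertDeflM80F : weilCertDeflM80FBase.checkHpRowT weilCertDeflM80FHpO 1 50 = true := by
  decide +kernel

/-- Claim row 50 of `Hp = C H Cᵀ` (parity 1), from the fast check. [folklore] -/
theorem checkHpRow1_50_weilCertDeflM80F : weilCertDeflM80FBase.checkHpRow weilCertDeflM80FHpO 1 50 = true :=
  WeilCert.checkHpRow_of_T checkHpRowT1_50_weilCertDeflM80F

set_option maxHeartbeats 0 in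
/-- Fast kernel check of claim row 51 of `Hp = C H Cᵀ` (parity 1; linear traversals, triangular `C`). [folklore] -/
theorem checkHpRowT1_51_weilCertDeflM80F : weilCertDeflM80FBase.checkHpRowT weilCertDeflM80FHpO 1 51 = true := by
  decide +kernel

/-- Claim row 51 of `Hp = C H Cᵀ` (parity 1), from the fast check. [folklore] -/
theorem checkHpRow1_51_weilCertDeflM80F : weilCertDeflM80FBase.checkHpRow weilCertDeflM80FHpO 1 51 = true :=
  WeilCert.checkHpRow_of_T checkHpRowT1_51_weilCertDeflM80F

set_option maxHeartbeats 0 in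
/-- Fast kernel check of claim row 52 of `Hp = C H Cᵀ` (parity 1; linear traversals, triangular `C`). [folklore] -/
theorem checkHpRowT1_52_weilCertDeflM80F : weilCertDeflM80FBase.checkHpRowT weilCertDeflM80FHpO 1 52 = true := by
  decide +kernel

/-- Claim row 52 of `Hp = C H Cᵀ` (parity 1), from the fast check. [folklore] -/
theorem checkHpRow1_52_weilCertDeflM80F : weilCertDeflM80FBase.checkHpRow weilCertDeflM80FHpO 1 52 = true :=
  WeilCert.checkHpRow_of_T checkHpRowT1_52_weilCertDeflM80F

set_option maxHeartbeats 0 in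
/-- Fast kernel check of claim row 53 of `Hp = C H Cᵀ` (parity 1; linear traversals, triangular `C`). [folklore] -/
theorem checkHpRowT1_53_weilCertDeflM80F : weilCertDeflM80FBase.checkHpRowT weilCertDeflM80FHpO 1 53 = true := by
  decide +kernel

/-- Claim row 53 of `Hp = C H Cᵀ` (parity 1), from the fast check. [folklore] -/
theorem checkHpRow1_53_weilCertDeflM80F : weilCertDeflM80FBase.checkHpRow weilCertDeflM80FHpO 1 53 = true :=
  WeilCert.checkHpRow_of_T checkHpRowT1_53_weilCertDeflM80F

set_option maxHeartbeats 0 in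
/-- Fast kernel check of claim row 54 of `Hp = C H Cᵀ` (parity 1; linear traversals, triangular `C`). [folklore] -/
theorem checkHpRowT1_54_weilCertDeflM80F : weilCertDeflM80FBase.checkHpRowT weilCertDeflM80FHpO 1 54 = true := by
  decide +kernel

/-- Claim row 54 of `Hp = C H Cᵀ` (parity 1), from the fast check. [folklore] -/
theorem checkHpRow1_54_weilCertDeflM80F : weilCertDeflM80FBase.checkHpRow weilCertDeflM80FHpO 1 54 = true :=
  WeilCert.checkHpRow_of_T checkHpRowT1_54_weilCertDeflM80F

end Summit.RiemannHypothesis.RiemannHypothesis.Theorems.EvenWinsBeyondArch
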